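import Literature.Probability.RandomPlanarGeometry.SLEArcConfinement
import Literature.Probability.RandomPlanarGeometry.SLE
import Literature.Probability.RandomPlanarGeometry.CurveSpace
import Literature.Probability.RandomPlanarGeometry.CaratheodoryHalfPlaneProofs
import Literature.Probability.RandomPlanarGeometry.StoppedCompactifiedImage
import Literature.Probability.RandomPlanarGeometry.DrivingFunctionMeasurable
import Literature.Probability.RandomPlanarGeometry.LoewnerDescriptionProofs
import Mathlib.LinearAlgebra.AffineSpace.FiniteDimensional
import HarnessLib

/-!
# No traced straight segments: the collinear-tracing event and the SLE_κ curve, `4 < κ < 8`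

Topic `Probability/RandomPlanarGeometry`; theorems only (regularity of the chordal SLE₆ family for
the refutation of crux `stmt-CriticalPhenomena-0698`, hypothesis `SLESixNoTracedSegment` /
`NoTracedSegment` of the disprover's one-shot surgery skeleton).

* `CurveClass.isClosed_setOf_subarc_collinear`, **`CurveClass.measurableSet_setOf_tracesLine`** —
  on a metric curve space over `ℂ`, the event "some representative maps a non-trivial parameter
  interval NON-CONSTANTLY into a straight line" is Borel: it is the countable union over
  `ε = 1/(n+1)` of the CLOSED events "some representative `c` and `s ≤ t` with
  `ε ≤ dist (c s) (c t)` and `c u` on the line through `c s, c t` for all `u ∈ [s, t]`" (a pointwise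
  closed condition; closedness along sup-close reparametrisations and a convergent subsequence of
  witnesses, as for the boundary-tracing event of the non-tracing theorem).
* **`IsSLECurve.ae_forall_not_collinear_image`** — for an SLE_κ random curve in a Dobrushin
  domain, `4 < κ < 8`, almost surely the compactified image `c₀` of the trace (`Γ ω = mk c₀`) has
  NO collinear sub-arc image `c₀ '' [s, t]`, `s < t`: a collinear piece `Φ(γ[a, b])` would make the
  continuous real function `ρ = (coordinate along the line) ∘ Φ ∘ liftIm` injective on `γ[a, b]`
  (`Φ` is injective on the closed half-plane, boundary correspondence), contradicting arc
  confinement (`ae_not_injOn_sleTrace`, `SLEArcConfinement`).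

The law-level statement for all representatives (`∀ᵐ γ ∂μ, ∀ c, mk c = γ → …`) follows
Summit-side from the invariance of the family of sub-arc images under reparametrisation.

References: S. Rohde, O. Schramm, *Basic properties of SLE*, Ann. of Math. 161 (2005), §7;
M. Aizenman, A. Burchard, Duke Math. J. 99 (1999), §2.1 (curve space).
-/

noncomputable section

open Set Filter Topology MeasureTheory Metric

open scoped NNReal unitInterval

namespace Literature.Probability.RandomPlanarGeometry

/-! ### The parallelism form -/

/-- `crossIm z w = Im (z * conj w)`: vanishes iff `z` and `w` are parallel. [folklore] -/
def crossIm (z w : ℂ) : ℝ := (z * (starRingEnd ℂ) w).im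

/-- Formula for `crossIm`. [folklore] -/
theorem crossIm_apply (z w : ℂ) : crossIm z w = z.im * w.re - z.re * w.im := by
  simp [crossIm, Complex.mul_im, Complex.conj_re, Complex.conj_im]
  ring

/-- `crossIm` is continuous. [folklore] -/
theorem continuous_crossIm : Continuous fun p : ℂ × ℂ ↦ crossIm p.1 p.2 := by
  have : (fun p : ℂ × ℂ ↦ crossIm p.1 p.2) = fun p ↦ p.1.im * p.2.re - p.1.re * p.2.im := by
    funext p; exact crossIm_apply _ _
  rw [this]
  fun_prop

/-- Real multiples are parallel: `crossIm (r • w) (r' • w) = 0`. [folklore] -/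
theorem crossIm_smul_smul (r r' : ℝ) (w : ℂ) : crossIm (r • w) (r' • w) = 0 := by
  rw [crossIm_apply]
  simp
  ring

/-- Parallel to a non-zero vector means a real multiple of it. [folklore] -/
theorem exists_eq_smul_of_crossIm_eq_zero {z w : ℂ} (hw : w ≠ 0) (h : crossIm z w = 0) :
    ∃ r : ℝ, z = r • w := by
  rw [crossIm_apply] at h
  have hn : w.re * w.re + w.im * w.im ≠ 0 := by
    intro h0
    apply hw
    have hre : w.re = 0 := by nlinarith [sq_nonneg w.re, sq_nonneg w.im]
    have him : w.im = 0 := by nlinarith [sq_nonneg w.re, sq_nonneg w.im]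
    exact Complex.ext hre him
  refine ⟨(z.re * w.re + z.im * w.im) / (w.re * w.re + w.im * w.im), ?_⟩
  apply Complex.ext
  · rw [Complex.smul_re, smul_eq_mul, div_mul_eq_mul_div, eq_div_iff hn]
    linear_combination (-w.im) * h
  · rw [Complex.smul_im, smul_eq_mul, div_mul_eq_mul_div, eq_div_iff hn]
    linear_combination w.re * h

/-- **Collinear sets through the line of two of their points.** If `S` is collinear and
`p, q ∈ S`, then every point of `S` is on the line through `p` parallel to `q - p`:
`crossIm (x - p) (q - p) = 0`. [folklore] -/
theorem Collinear.crossIm_eq_zero {S : Set ℂ} (hS : Collinear ℝ S) {p q x : ℂ} (hp : p ∈ S)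
    (hq : q ∈ S) (hx : x ∈ S) : crossIm (x - p) (q - p) = 0 := by
  obtain ⟨v, hv⟩ := (collinear_iff_of_mem hp).1 hS
  obtain ⟨rq, hrq⟩ := hv q hq
  obtain ⟨rx, hrx⟩ := hv x hx
  have hq' : q - p = rq • v := by rw [hrq]; simp [vadd_eq_add]
  have hx' : x - p = rx • v := by rw [hrx]; simp [vadd_eq_add]
  rw [hq', hx']
  exact crossIm_smul_smul _ _ _

/-- **Conversely**: if all points of `S` are on the line through `p ∈ S` parallel to `q - p ≠ 0`,
`S` is collinear. [folklore] -/
theorem collinear_of_forall_crossIm_eq_zero {S : Set ℂ} {p q : ℂ} (hp : p ∈ S) (hpq : q ≠ p)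
    (h : ∀ x ∈ S, crossIm (x - p) (q - p) = 0) : Collinear ℝ S := by
  rw [collinear_iff_of_mem hp]
  refine ⟨q - p, fun x hx ↦ ?_⟩
  obtain ⟨r, hr⟩ := exists_eq_smul_of_crossIm_eq_zero (sub_ne_zero.2 hpq) (h x hx)
  exact ⟨r, by rw [vadd_eq_add, ← hr]; ring⟩

/-! ### The collinear-tracing event is Borel -/

section TracingEvent

/-- **The quantitative collinear-tracing event is closed**: curve classes with a representative
`c` and `s ≤ t` such that every `c u`, `u ∈ [s, t]`, is on the line through `c s, c t` and
`ε ≤ dist (c s) (c t)`. [cite: AizenmanBurchard1999, §2.1] -/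
theorem CurveClass.isClosed_setOf_subarc_collinear (ε : ℝ) :
    IsClosed {γ : CurveClass ℂ | ∃ c : Curve ℂ, CurveClass.mk c = γ ∧ ∃ s t : I, s ≤ t ∧
      (∀ u ∈ Icc s t, crossIm (c u - c s) (c t - c s) = 0) ∧ ε ≤ dist (c s) (c t)} := by
  refine IsSeqClosed.isClosed fun x γ hx hlim ↦ ?_
  obtain ⟨c, rfl⟩ := CurveClass.surjective_mk γ
  choose c' hmk s t hst hcol hε using hx
  -- sup-close reparametrisations of the representatives `c' n`
  have hdist : Tendsto (fun n ↦ dist c (c' n)) atTop (𝓝 0) := by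
    refine (tendsto_iff_dist_tendsto_zero.1 hlim).congr fun n ↦ ?_
    rw [← hmk n, CurveClass.dist_mk_mk, dist_comm]
  set δ : ℕ → ℝ := fun n ↦ dist c (c' n) + 1 / ((n : ℝ) + 1) with hδ
  have hδlim : Tendsto δ atTop (𝓝 0) := by
    have h := hdist.add tendsto_one_div_add_atTop_nhds_zero_nat
    rw [add_zero] at h
    exact h
  have hex : ∀ n, ∃ φ : I ≃o I,
      dist c.toContinuousMap ((c' n).reparam φ).toContinuousMap < δ n := fun n ↦
    Curve.exists_dist_reparam_lt (lt_add_of_pos_right _ (by positivity))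
  choose φ hφ using hex
  have hpt : ∀ n (w : I), dist (c w) (c' n (φ n w)) < δ n := fun n w ↦
    (ContinuousMap.dist_apply_le_dist (f := c.toContinuousMap)
      (g := ((c' n).reparam (φ n)).toContinuousMap) w).trans_lt (hφ n)
  -- pulled-back witnesses and a convergent subsequence in `[0, 1]²`
  set s' : ℕ → I := fun n ↦ (φ n).symm (s n) with hs'
  set t' : ℕ → I := fun n ↦ (φ n).symm (t n) with ht'
  have hφs : ∀ n, φ n (s' n) = s n := fun n ↦ (φ n).apply_symm_apply _
  have hφt : ∀ n, φ n (t' n) = t n := fun n ↦ (φ n).apply_symm_apply _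
  have hs't' : ∀ n, s' n ≤ t' n := fun n ↦ (φ n).symm.monotone (hst n)
  obtain ⟨⟨s₀, t₀⟩, ψ, hψ, hlim'⟩ := CompactSpace.tendsto_subseq fun n ↦ (s' n, t' n)
  have hs₀ : Tendsto (fun k ↦ s' (ψ k)) atTop (𝓝 s₀) := hlim'.fst_nhds
  have ht₀ : Tendsto (fun k ↦ t' (ψ k)) atTop (𝓝 t₀) := hlim'.snd_nhds
  -- evaluation of the reparametrised representatives along the subsequence converges to `c`
  have hkey : ∀ {w : ℕ → I} {w₀ : I}, Tendsto w atTop (𝓝 w₀) →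
      Tendsto (fun k ↦ c' (ψ k) (φ (ψ k) (w k))) atTop (𝓝 (c w₀)) := by
    intro w w₀ hw
    rw [tendsto_iff_dist_tendsto_zero]
    have h1 : Tendsto (fun k ↦ dist (c (w k)) (c w₀)) atTop (𝓝 0) :=
      tendsto_iff_dist_tendsto_zero.1 ((c.continuous.tendsto w₀).comp hw)
    have h2 : Tendsto (fun k ↦ δ (ψ k)) atTop (𝓝 0) := hδlim.comp hψ.tendsto_atTop
    refine squeeze_zero (fun _ ↦ dist_nonneg) (fun k ↦ ?_) (by simpa using h2.add h1)
    calc dist (c' (ψ k) (φ (ψ k) (w k))) (c w₀)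
        ≤ dist (c' (ψ k) (φ (ψ k) (w k))) (c (w k)) + dist (c (w k)) (c w₀) :=
          dist_triangle _ _ _
      _ ≤ δ (ψ k) + dist (c (w k)) (c w₀) := by
          gcongr
          rw [dist_comm]
          exact (hpt (ψ k) (w k)).le
  -- the limit witnesses
  have h₀st : s₀ ≤ t₀ := le_of_tendsto_of_tendsto' hs₀ ht₀ fun k ↦ hs't' (ψ k)
  have hcol₀ : ∀ w ∈ Icc s₀ t₀, crossIm (c w - c s₀) (c t₀ - c s₀) = 0 := by
    intro w hw
    set wk : ℕ → I := fun k ↦ max (s' (ψ k)) (min w (t' (ψ k))) with hwk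
    have hwlim : Tendsto wk atTop (𝓝 w) := by
      have : Tendsto wk atTop (𝓝 (max s₀ (min w t₀))) := hs₀.max (tendsto_const_nhds.min ht₀)
      rwa [min_eq_left hw.2, max_eq_right hw.1] at this
    -- the expression along the subsequence is identically `0` and converges to the limit value
    have hconv : Tendsto (fun k ↦ crossIm (c' (ψ k) (φ (ψ k) (wk k)) - c' (ψ k) (φ (ψ k) (s' (ψ k))))
        (c' (ψ k) (φ (ψ k) (t' (ψ k))) - c' (ψ k) (φ (ψ k) (s' (ψ k))))) atTop
        (𝓝 (crossIm (c w - c s₀) (c t₀ - c s₀))) := by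
      have hp := ((hkey hwlim).sub (hkey hs₀)).prodMk_nhds ((hkey ht₀).sub (hkey hs₀))
      exact (continuous_crossIm.tendsto _).comp hp
    have hzero : ∀ k, crossIm (c' (ψ k) (φ (ψ k) (wk k)) - c' (ψ k) (φ (ψ k) (s' (ψ k))))
        (c' (ψ k) (φ (ψ k) (t' (ψ k))) - c' (ψ k) (φ (ψ k) (s' (ψ k)))) = 0 := by
      intro k
      rw [hφs, hφt]
      refine hcol (ψ k) _ ⟨?_, ?_⟩
      · have := (φ (ψ k)).monotone (le_max_left (s' (ψ k)) (min w (t' (ψ k))))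
        rwa [hφs] at this
      · have := (φ (ψ k)).monotone (max_le (hs't' (ψ k)) (min_le_right w (t' (ψ k))))
        rwa [hφt] at this
    exact tendsto_nhds_unique hconv (tendsto_const_nhds.congr fun k ↦ (hzero k).symm)
  have hεlim : ε ≤ dist (c s₀) (c t₀) := by
    refine ge_of_tendsto' ((hkey hs₀).dist (hkey ht₀)) fun k ↦ ?_
    change ε ≤ dist (c' (ψ k) (φ (ψ k) (s' (ψ k)))) (c' (ψ k) (φ (ψ k) (t' (ψ k))))
    rw [hφs, hφt]
    exact hε (ψ k)
  exact ⟨c, rfl, s₀, t₀, h₀st, hcol₀, hεlim⟩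

/-- **The collinear-tracing event is Borel**: curve classes with a representative mapping some
parameter interval `[s, t]`, `s < t`, non-constantly into a straight line.
[cite: AizenmanBurchard1999, §2.1] -/
theorem CurveClass.measurableSet_setOf_tracesLine :
    MeasurableSet {γ : CurveClass ℂ | ∃ c : Curve ℂ, CurveClass.mk c = γ ∧ ∃ s t : I, s < t ∧
      Collinear ℝ ((c : I → ℂ) '' Icc s t) ∧ ¬ ((c : I → ℂ) '' Icc s t).Subsingleton} := by
  have heq : {γ : CurveClass ℂ | ∃ c : Curve ℂ, CurveClass.mk c = γ ∧ ∃ s t : I, s < t ∧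
      Collinear ℝ ((c : I → ℂ) '' Icc s t) ∧ ¬ ((c : I → ℂ) '' Icc s t).Subsingleton} =
      ⋃ n : ℕ, {γ : CurveClass ℂ | ∃ c : Curve ℂ, CurveClass.mk c = γ ∧ ∃ s t : I, s ≤ t ∧
        (∀ u ∈ Icc s t, crossIm (c u - c s) (c t - c s) = 0) ∧
          1 / ((n : ℝ) + 1) ≤ dist (c s) (c t)} := by
    ext γ
    simp only [mem_setOf_eq, mem_iUnion]
    constructor
    · rintro ⟨c, hc, s, t, hst, hcol, hns⟩
      obtain ⟨_, ⟨u, hu, rfl⟩, _, ⟨v, hv, rfl⟩, hne⟩ := not_subsingleton_iff.1 hns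
      obtain ⟨n, hn⟩ := exists_nat_one_div_lt (dist_pos.2 hne)
      -- order the two witnesses
      rcases le_total u v with huv | huv
      · refine ⟨n, c, hc, u, v, huv, fun w hw ↦ ?_, hn.le⟩
        exact Collinear.crossIm_eq_zero hcol ⟨u, hu, rfl⟩ ⟨v, hv, rfl⟩
          ⟨w, ⟨hu.1.trans hw.1, hw.2.trans hv.2⟩, rfl⟩
      · refine ⟨n, c, hc, v, u, huv, fun w hw ↦ ?_, by rw [dist_comm]; exact hn.le⟩
        exact Collinear.crossIm_eq_zero hcol ⟨v, hv, rfl⟩ ⟨u, hu, rfl⟩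
          ⟨w, ⟨hv.1.trans hw.1, hw.2.trans hu.2⟩, rfl⟩
    · rintro ⟨n, c, hc, s, t, hst, hcol, hn⟩
      have hne : c s ≠ c t := dist_pos.1 (lt_of_lt_of_le (by positivity) hn)
      have hst' : s < t := hst.lt_of_ne (by rintro rfl; exact hne rfl)
      refine ⟨c, hc, s, t, hst', ?_, fun hsing ↦ hne (hsing ⟨s, ⟨le_rfl, hst⟩, rfl⟩
        ⟨t, ⟨hst, le_rfl⟩, rfl⟩)⟩
      refine collinear_of_forall_crossIm_eq_zero ⟨s, ⟨le_rfl, hst⟩, rfl⟩ hne.symm ?_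
      rintro _ ⟨w, hw, rfl⟩
      exact hcol w hw
  rw [heq]
  exact MeasurableSet.iUnion fun n ↦ (CurveClass.isClosed_setOf_subarc_collinear _).measurableSet

end TracingEvent

/-! ### The SLE_κ curve has no collinear sub-arc images, `4 < κ < 8` -/

section SLE

open UpperHalfPlane (upperHalfPlaneSet)

variable {κ : ℝ≥0} {D : DobrushinDomain}

/-- `rayParam` is strictly increasing below `1`. [folklore] -/
theorem rayParam_lt_rayParam_of_lt {a b : I} (hab : a < b) (hb : (b : ℝ) < 1) :
    rayParam a < rayParam b := by
  have ha : (a : ℝ) < 1 := lt_of_lt_of_le (show (a : ℝ) < b from hab) hb.le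
  rw [← NNReal.coe_lt_coe, coe_rayParam, coe_rayParam, div_lt_div_iff₀ (sub_pos.2 ha) (sub_pos.2 hb)]
  have : (a : ℝ) < b := hab
  nlinarith

/-- `rayParam` is monotone below `1`. [folklore] -/
theorem rayParam_le_rayParam_of_le {a b : I} (hab : a ≤ b) (hb : (b : ℝ) < 1) :
    rayParam a ≤ rayParam b := by
  rcases hab.lt_or_eq with h | rfl
  · exact (rayParam_lt_rayParam_of_lt h hb).le
  · exact le_rfl

/-- **Almost surely the compactified SLE_κ curve has no collinear sub-arc image**, `4 < κ < 8`.
[cite: RohdeSchramm2005, §7] -/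
theorem IsSLECurve.ae_forall_not_collinear_image (hκ4 : 4 < κ) (hκ8 : κ < 8)
    {Γ : (ℝ≥0 → ℝ) → CurveClass ℂ} (hΓ : IsSLECurve κ D Γ) :
    ∀ᵐ ω ∂Process.preWienerMeasure, ∃ c₀ : Curve ℂ, Γ ω = CurveClass.mk c₀ ∧
      ∀ s t : I, s < t → ¬ Collinear ℝ ((c₀ : I → ℂ) '' Icc s t) := by
  obtain ⟨-, φ, hφ, hae⟩ := hΓ
  filter_upwards [hae, ae_not_injOn_sleTrace hκ4 hκ8] with ω hω harc
  obtain ⟨hgen, c₀, hc₀, himg⟩ := hω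
  refine ⟨c₀, hc₀, fun s t hst hcol ↦ ?_⟩
  -- shrink to `[s, m]`, `m = (s + t)/2 < 1`
  have hsm : (s : ℝ) < ((s : ℝ) + t) / 2 := by
    have : (s : ℝ) < t := hst
    linarith
  have hmt : ((s : ℝ) + t) / 2 < 1 := by
    have h1 : (t : ℝ) ≤ 1 := t.2.2
    have : (s : ℝ) < t := hst
    linarith
  set m : I := ⟨((s : ℝ) + t) / 2, by constructor <;> nlinarith [s.2.1, t.2.1, s.2.2, t.2.2]⟩ with hm
  have hsm' : s < m := hsm
  have hmt' : m ≤ t := by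
    change ((s : ℝ) + t) / 2 ≤ t
    have : (s : ℝ) < t := hst
    linarith
  have hm1 : (m : ℝ) < 1 := hmt
  set a : ℝ≥0 := rayParam s with ha
  set b : ℝ≥0 := rayParam m with hb
  have hab : a < b := rayParam_lt_rayParam_of_lt hsm' hm1
  -- the piece `Φ(γ[a, b])` sits inside the collinear set
  set Φ : ℂ → ℂ := φ.boundaryExtension with hΦdef
  set Φp : ℂ → ℂ := fun z ↦ Φ (Loewner.liftIm 0 z) with hΦpdef
  have hΦpc : Continuous Φp := continuous_boundaryExtension_liftIm φ
  have hΦp_eq : ∀ {z : ℂ}, 0 ≤ z.im → Φp z = Φ z := fun hz ↦ by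
    simp only [hΦpdef, Loewner.liftIm_of_le hz]
  have hsub : Φ '' (sleTrace κ ω '' Icc a b) ⊆ (c₀ : I → ℂ) '' Icc s t := by
    rintro _ ⟨_, ⟨τ, hτ, rfl⟩, rfl⟩
    -- `τ = rayParam u` for some `u ∈ [s, m]`
    set u : I := ⟨(τ : ℝ) / (1 + τ), rayParamInv_mem_Icc τ⟩ with hu
    have hτu : rayParam u = τ := rayParam_rayParamInv τ
    have hu1 : (u : ℝ) < 1 := rayParamInv_lt_one τ
    have hsu : s ≤ u := by
      by_contra hcon
      push Not at hcon
      have := rayParam_lt_rayParam_of_lt hcon (lt_of_le_of_lt (show (s : ℝ) ≤ m from hsm'.le) hm1)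
      rw [hτu] at this
      exact absurd hτ.1 (not_le.2 this)
    have hum : u ≤ m := by
      by_contra hcon
      push Not at hcon
      have := rayParam_lt_rayParam_of_lt hcon hu1
      rw [hτu] at this
      exact absurd hτ.2 (not_le.2 this)
    refine ⟨u, ⟨hsu, hum.trans hmt'⟩, ?_⟩
    rw [himg.1 u hu1, hτu]
  have hcol' : Collinear ℝ (Φ '' (sleTrace κ ω '' Icc a b)) := hcol.subset hsub
  -- injectivity of `Φ` on the closed half-plane
  have hinjΦ : InjOn Φ {z : ℂ | 0 ≤ z.im} := JordanDomain.injOn_boundaryExtension φ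
  have himnn : ∀ z ∈ sleTrace κ ω '' Icc a b, 0 ≤ z.im := by
    rintro _ ⟨τ, -, rfl⟩
    exact hgen.im_nonneg τ
  -- a continuous real function injective on `γ[a, b]`
  have hp : Φ (sleTrace κ ω a) ∈ Φ '' (sleTrace κ ω '' Icc a b) :=
    ⟨_, ⟨a, ⟨le_rfl, hab.le⟩, rfl⟩, rfl⟩
  obtain ⟨v, hv⟩ := (collinear_iff_of_mem hp).1 hcol'
  set p : ℂ := Φ (sleTrace κ ω a) with hpdef
  set ρ : ℂ → ℝ := fun z ↦ ((Φp z - p) * (starRingEnd ℂ) v).re with hρdef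
  have hρc : Continuous ρ := by
    have h1 : Continuous fun z ↦ (Φp z - p) * (starRingEnd ℂ) v :=
      (hΦpc.sub continuous_const).mul continuous_const
    exact Complex.continuous_re.comp h1
  refine harc a b hab ρ hρc fun z₁ hz₁ z₂ hz₂ heq ↦ ?_
  have hΦ₁ : Φ z₁ ∈ Φ '' (sleTrace κ ω '' Icc a b) := ⟨z₁, hz₁, rfl⟩
  have hΦ₂ : Φ z₂ ∈ Φ '' (sleTrace κ ω '' Icc a b) := ⟨z₂, hz₂, rfl⟩
  obtain ⟨r₁, hr₁⟩ := hv _ hΦ₁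
  obtain ⟨r₂, hr₂⟩ := hv _ hΦ₂
  have e₁ : Φ z₁ - p = r₁ • v := by rw [hr₁]; simp [vadd_eq_add]
  have e₂ : Φ z₂ - p = r₂ • v := by rw [hr₂]; simp [vadd_eq_add]
  have hρval : ∀ {z : ℂ} {r : ℝ}, 0 ≤ z.im → Φ z - p = r • v → ρ z = r * Complex.normSq v := by
    intro z r hz he
    change ((Φp z - p) * (starRingEnd ℂ) v).re = r * Complex.normSq v
    rw [hΦp_eq hz, he, Complex.real_smul, mul_assoc, Complex.mul_conj, ← Complex.ofReal_mul,
      Complex.ofReal_re]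
  have hρ₁ : ρ z₁ = r₁ * Complex.normSq v := hρval (himnn z₁ hz₁) e₁
  have hρ₂ : ρ z₂ = r₂ * Complex.normSq v := hρval (himnn z₂ hz₂) e₂
  apply hinjΦ (himnn z₁ hz₁) (himnn z₂ hz₂)
  rcases eq_or_ne v 0 with hv0 | hv0
  · -- degenerate line: all points coincide with `p`
    have h1 : Φ z₁ = p := by rw [← sub_eq_zero, e₁, hv0, smul_zero]
    have h2 : Φ z₂ = p := by rw [← sub_eq_zero, e₂, hv0, smul_zero]
    rw [h1, h2]
  · have hn : Complex.normSq v ≠ 0 := (Complex.normSq_pos.2 hv0).ne'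
    have hr : r₁ = r₂ := by
      have : r₁ * Complex.normSq v = r₂ * Complex.normSq v := by rw [← hρ₁, ← hρ₂]; exact heq
      exact mul_right_cancel₀ hn this
    rw [← sub_eq_zero, show Φ z₁ - Φ z₂ = (Φ z₁ - p) - (Φ z₂ - p) by ring, e₁, e₂, hr, sub_self]

end SLE

end Literature.Probability.RandomPlanarGeometry

end
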